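import Mathlib
import Summits.Ventures.AbcSig.Sieve.PolyWitness
import Summits.Ventures.AbcShadow.SH27.PowerTrace

/-!
# Venture AbcShadow — SH-27 NEWFORM SIDE: orbit data over `ℤ[i]` and the KERNEL sieve over all characteristic-17
# realisations of an orbit (checker + soundness)

HONEST FRAMING. Certificate-checker file of the work-bound cell `abc-shadow` (typer seat `abc-shadow-typ-4`, row SH-27 =
`a² + b³⁴ = c⁵`, [Che10, Thm 1]'s excluded prime `p = 17`). It proves NO Diophantine statement, makes no claim on abc, on any
summit, or on IUT, and does NOT verify any modular-form computation: that the orbit data ARE the newforms of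
`S₂(Γ₀(M), ψ)`, `M ∈ {180, 720}`, is the separately NAMED computed hypothesis `DataComplete` (`SH27/Che10Package.lean`),
backed outside Lean by certificate 1f9122f05be32705 (eng-2 g3, PARI/GP `mfinit`) and the critic's re-derivation
(crit-1-SH27-K3.md). What the kernel checks here, for CERTIFIED ORBIT DATA `o` of a newform orbit `g` with
`[K_g : ℚ(i)] = r` — a monic relative polynomial `P ∈ ℤ[i][y]` with `P(i, θ) = 0` and entries `(q, d_q, g_q)` meaning
`d_q · a_q(g) = g_q(i, θ)` — is that NO CHARACTERISTIC-17 REALISATION SURVIVES THE RESIDUE-CLASS SIEVE: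

* a realisation is `(k, ι, ȳ, (ā_q)_q)`: a field `k` of characteristic 17, `ι² = −1`, `P(ι, ȳ) = 0`, `d_q ā_q = g_q(ι, ȳ)`
  (intended: reduction modulo a prime `𝔓 ∣ 17` of the coefficient order, composed with `𝒪/𝔓 ↪ k`); then `ι = ±4`, and `ȳ` is
  a root of one of the listed monic factors `m` (degree 1 or 2, product `≡ P(ι₀, y) (mod 17)`, kernel-multiplied) —
  `orbitCheck`/`orbitCheck_sound` enumerate these finitely many TYPES and, in `𝔽₁₇[y]/(m)` (pairs over `ZMod 17`), compute
  `τ = ā_q`, `d = ι^{e(q)}·q` (the nebentypus value `ψ(q) = i^{e(q)}` times `q`) and the power trace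
  `L = p_f(τ, d)` (`f = f(q)` the residue degree of `q` in `K_β`, `SH27/PowerTrace.lean`);
* KILL at `q`: either `L ∉ 𝔽₁₇` (its `ȳ`-coordinate is nonzero while `m` is an irreducible quadratic — then `L` is no
  integer), or `L ∈ 𝔽₁₇` but `L ≢ A (mod 17)` for every `A` in the supplied list `R(q)` of realised curve traces;
* SOUNDNESS (`orbitCheck_sound`, in the sibling file `SH27/NewformSound.lean`): if the check passes then the hypothesis "for
  every listed prime `q` there is an integer `A` (lying in `R(q)` when `R(q)` is supplied) with `p_{f(q)}(ā_q, ι^{e(q)} q) = A`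
  in `k`" is contradictory. That hypothesis is what LEMMA-SH27-1 + the curve-side tables deliver in `SH27/RowP17.lean`.

Reuses the integer coefficient-list algebra of the sister venture (`Summit.Ventures.AbcSig.toPoly/mulL/addL/smulL`,
`Sieve/PolyWitness.lean`). The orbit DATA and the `decide` facts are in `SH27/NewformData*.lean`. This is the ideal-wise
("per prime `𝔓 ∣ 17`") bookkeeping U3 and the refinement U2 of the spec (ENGINE-SPEC-SH27 9d55c9c4a06f0a3d §2.3), sound for
ANY order `ℤ[i][θ]` (an entry with `17 ∣ d_q` carries no information and is never used). ADJACENT (generalized Fermat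
`(2, 34, 5)`), NOT abc. References: [Che10] I. Chen, Acta Arith. 143 (2010) 345–375, p.369 (the criterion).
-/

namespace Summit.Ventures.AbcShadow
namespace SH27

open Summit.Ventures.AbcSig (toPoly mulL addL smulL toPoly_mulL toPoly_addL toPoly_smulL toPoly_cons toPoly_nil)
open Polynomial

/-! ## Orbit data over `ℤ[i]` and their evaluation -/

/-- An element of `ℤ[i][y]`: little-endian list of coefficients `(a, b) = a + b·i`. [folklore] -/
abbrev QiPoly := List (ℤ × ℤ)

/-- One certified Hecke eigenvalue of an orbit: at the prime `q`, `d · a_q(g) = g(i, θ)` with `g ∈ ℤ[i][y]`, `d ∈ ℤ ∖ 0`.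
[folklore] -/
structure Entry27 where
  /-- the prime `q` -/
  q : ℕ
  /-- denominator `d` -/
  d : ℤ
  /-- numerator `g(i, y)` -/
  g : QiPoly
  deriving DecidableEq, Repr

/-- Certified data of one `Gal(ℚ̄/ℚ(i))`-orbit of newforms: the relative polynomial `P ∈ ℤ[i][y]` (`P(i, θ) = 0`, `θ` the
engine's generator of `K_g` over `ℚ(i)`) and eigenvalue entries. Transcribed from certificate 1f9122f05be32705 block (N).
[folklore] -/
structure Orbit27 where
  /-- relative polynomial over `ℤ[i]` -/
  P : QiPoly
  /-- entries `(q, d, g)` -/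
  entries : List Entry27
  deriving Repr

/-- Evaluation of `p ∈ ℤ[i][y]` at `i ↦ ι`, `y ↦ θ` in a commutative ring (Horner). [folklore] -/
def evalQi {R : Type*} [CommRing R] (ι θ : R) : QiPoly → R
  | [] => 0
  | ab :: p => ((ab.1 : R) + (ab.2 : R) * ι) + θ * evalQi ι θ p

/-- Ring homomorphisms commute with `evalQi`. [folklore] -/
theorem map_evalQi {R S : Type*} [CommRing R] [CommRing S] (φ : R →+* S) (ι θ : R) :
    ∀ p : QiPoly, φ (evalQi ι θ p) = evalQi (φ ι) (φ θ) p
  | [] => by simp [evalQi]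
  | ab :: p => by simp [evalQi, map_evalQi φ ι θ p]

/-- Specialisation `i ↦ i₀ ∈ ℤ`: the integer coefficient list `[a_j + b_j i₀]_j`. [folklore] -/
def specQi (i0 : ℤ) (p : QiPoly) : List ℤ := p.map fun ab => ab.1 + ab.2 * i0

/-- Evaluation of an integer coefficient list at `θ` (through `AbcSig.toPoly`; never computed). [folklore] -/
noncomputable def evalZ {R : Type*} [CommRing R] (θ : R) (p : List ℤ) : R := (toPoly p).eval₂ (Int.castRingHom R) θ

section evalZ
variable {R : Type*} [CommRing R] (θ : R)

/-- `evalZ θ [] = 0`. [folklore] -/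
@[simp] theorem evalZ_nil : evalZ θ [] = 0 := by simp [evalZ]

/-- Horner step. [folklore] -/
@[simp] theorem evalZ_cons (a : ℤ) (p : List ℤ) : evalZ θ (a :: p) = (a : R) + θ * evalZ θ p := by
  rw [evalZ, evalZ, toPoly_cons, eval₂_add, eval₂_C, eval₂_mul, eval₂_X]
  rfl

/-- `evalZ` is multiplicative on `mulL`. [folklore] -/
theorem evalZ_mulL (p r : List ℤ) : evalZ θ (mulL p r) = evalZ θ p * evalZ θ r := by
  rw [evalZ, evalZ, evalZ, toPoly_mulL, eval₂_mul]

/-- `evalZ` is additive on `addL`. [folklore] -/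
theorem evalZ_addL (p r : List ℤ) : evalZ θ (addL p r) = evalZ θ p + evalZ θ r := by
  rw [evalZ, evalZ, evalZ, toPoly_addL, eval₂_add]

/-- `evalZ` and `smulL`. [folklore] -/
theorem evalZ_smulL (c : ℤ) (p : List ℤ) : evalZ θ (smulL c p) = (c : R) * evalZ θ p := by
  rw [evalZ, evalZ, toPoly_smulL, eval₂_mul, eval₂_C]
  rfl

/-- `evalQi` at an integer `i₀` is `evalZ` of the specialised list. [folklore] -/
theorem evalQi_intCast (i0 : ℤ) : ∀ p : QiPoly, evalQi (i0 : R) θ p = evalZ θ (specQi i0 p)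
  | [] => by simp [evalQi, specQi]
  | ab :: p => by
      rw [evalQi, evalQi_intCast i0 p]
      simp [specQi]

/-- A list with all coefficients divisible by 17 evaluates to `0` in characteristic 17. [folklore] -/
theorem evalZ_eq_zero_of_mod17 [CharP R 17] : ∀ p : List ℤ, (p.all fun c => c % 17 == 0) = true → evalZ θ p = 0
  | [], _ => by simp
  | a :: p, h => by
      simp only [List.all_cons, Bool.and_eq_true, beq_iff_eq] at h
      have ha : (a : R) = 0 := (CharP.intCast_eq_zero_iff R 17 a).mpr (Int.dvd_of_emod_eq_zero h.1)
      rw [evalZ_cons, ha, evalZ_eq_zero_of_mod17 p h.2]; simp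

end evalZ

/-! ## Factorisations mod 17 -/

/-- A monic factor of degree 1 (`quad = false`: `y + m₀`) or 2 (`quad = true`: `y² + m₁y + m₀`). [folklore] -/
structure Fac where
  /-- degree 2? -/
  quad : Bool
  /-- constant coefficient -/
  m0 : ℤ
  /-- linear coefficient (ignored for degree 1) -/
  m1 : ℤ
  deriving DecidableEq, Repr

/-- The coefficient list of a factor. [folklore] -/
def Fac.toList (f : Fac) : List ℤ := if f.quad then [f.m0, f.m1, 1] else [f.m0, 1]

/-- Product of a list of coefficient lists. [folklore] -/
def prodL : List (List ℤ) → List ℤ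
  | [] => [1]
  | m :: ms => mulL m (prodL ms)

/-- `evalZ` of a product list is the product. [folklore] -/
theorem evalZ_prodL {R : Type*} [CommRing R] (θ : R) : ∀ ms : List (List ℤ),
    evalZ θ (prodL ms) = (ms.map (evalZ θ)).prod
  | [] => by simp [prodL]
  | m :: ms => by rw [prodL, evalZ_mulL, evalZ_prodL θ ms]; simp

/-- **Factorisation check mod 17**: `∏ factors ≡ target` coefficientwise mod 17. [folklore] -/
def prodCheck (target : List ℤ) (factors : List (List ℤ)) : Bool :=
  (addL (prodL factors) (smulL (-1) target)).all fun c => c % 17 == 0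

/-- Soundness of the factorisation check in characteristic 17. [folklore] -/
theorem prodCheck_sound {R : Type*} [CommRing R] [CharP R 17] (θ : R) {target : List ℤ} {factors : List (List ℤ)}
    (h : prodCheck target factors = true) : evalZ θ target = (factors.map (evalZ θ)).prod := by
  have h0 := evalZ_eq_zero_of_mod17 θ _ h
  rw [evalZ_addL, evalZ_smulL, evalZ_prodL] at h0
  have : ((-1 : ℤ) : R) = -1 := by simp
  rw [this] at h0
  linear_combination -h0

/-- Shape check of a factor: a quadratic factor must be IRREDUCIBLE mod 17 (no root in `ZMod 17`). [folklore] -/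
def factorOK (f : Fac) : Bool :=
  if f.quad then decide (∀ r : ZMod 17, r * r + (f.m1 : ZMod 17) * r + (f.m0 : ZMod 17) ≠ 0) else true

/-! ## The residue algebra `𝔽₁₇[y]/(m)` as pairs over `ZMod 17` -/

/-- Pairs `(a, b) = a + b·ȳ`. [folklore] -/
abbrev R17 := ZMod 17 × ZMod 17

/-- Multiplication with `ȳ² = n₁ȳ + n₀` (`n = (n₀, n₁)`). [folklore] -/
def mul17 (n : ZMod 17 × ZMod 17) (x y : R17) : R17 :=
  (x.1 * y.1 + n.1 * (x.2 * y.2), x.1 * y.2 + x.2 * y.1 + n.2 * (x.2 * y.2))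

/-- The relation `ȳ² = n₁ȳ + n₀` attached to a factor: `(0, −m₀)` for `y + m₀` (whose root is `ȳ = −m₀`), `(−m₀, −m₁)`
for `y² + m₁y + m₀`. [folklore] -/
def relOf (f : Fac) : ZMod 17 × ZMod 17 :=
  if f.quad then (-(f.m0 : ZMod 17), -(f.m1 : ZMod 17)) else (0, -(f.m0 : ZMod 17))

/-- The representative of `ȳ`: `(−m₀, 0) ∈ 𝔽₁₇` for a linear factor, `(0, 1)` for a quadratic one. [folklore] -/
def ybarOf (f : Fac) : R17 := if f.quad then (0, 1) else (-(f.m0 : ZMod 17), 0)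

/-- Evaluate `g ∈ ℤ[i][y]` at `i ↦ i₀`, `y ↦ ȳ` in the pair algebra. [folklore] -/
def evalQiR (n : ZMod 17 × ZMod 17) (i0 : ZMod 17) (yb : R17) : QiPoly → R17
  | [] => (0, 0)
  | ab :: p => (((ab.1 : ZMod 17) + (ab.2 : ZMod 17) * i0, 0) : R17) + mul17 n yb (evalQiR n i0 yb p)

/-- The power trace `p_f(τ, d)` in the pair algebra for `f ∈ {1, 2, 4}` (`d ∈ 𝔽₁₇` a scalar); junk `(0,0)` otherwise (the
checker refuses other `f`). [folklore] -/
def ptPair (n : ZMod 17 × ZMod 17) : ℕ → R17 → ZMod 17 → R17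
  | 1, τ, _ => τ
  | 2, τ, d => mul17 n τ τ - ((2 * d, 0) : R17)
  | 4, τ, d => mul17 n (mul17 n τ τ) (mul17 n τ τ) - (4 * d) • mul17 n τ τ + ((2 * d * d, 0) : R17)
  | _, _, _ => (0, 0)

/-- An inverse of `d` mod 17, if any (search). [folklore] -/
def inv17 (d : ℤ) : Option (ZMod 17) :=
  ((List.range 17).find? fun x => (d : ZMod 17) * (x : ZMod 17) = 1).map fun x => (x : ZMod 17)

/-- `notRealised R L₁`: a list of realised traces is supplied and none is `≡ L₁ (mod 17)`. [folklore] -/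
def notRealised (R : Option (List ℤ)) (L1 : ZMod 17) : Bool :=
  match R with
  | none => false
  | some l => l.all fun A => decide ((A : ZMod 17) ≠ L1)

/-- **Kill test at the prime `q` for the realisation type `(i₀, f)`** (module docstring): with the entry `(q, d, g)` of the
orbit (`17 ∤ d`), `τ = d⁻¹ g(i₀, ȳ)`, `dd = i₀^{e(q)} q`, `L = p_{f(q)}(τ, dd)`: killed iff `L ∉ 𝔽₁₇` (quadratic factor) or
`R(q) = some l` and `L ≢ A (mod 17)` for all `A ∈ l`. [folklore] -/
def killAt (o : Orbit27) (e fd : ℕ → ℕ) (R : ℕ → Option (List ℤ)) (i0 : ℤ) (f : Fac) (q : ℕ) : Bool :=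
  match o.entries.find? (fun en => en.q == q) with
  | none => false
  | some en =>
    match inv17 en.d with
    | none => false
    | some dinv =>
      let L := ptPair (relOf f) (fd q) (dinv • evalQiR (relOf f) (i0 : ZMod 17) (ybarOf f) en.g)
        ((i0 : ZMod 17) ^ e q * (q : ZMod 17))
      (fd q == 1 || fd q == 2 || fd q == 4) &&
        ((f.quad && decide (L.2 ≠ 0)) || (decide (L.2 = 0) && notRealised (R q) L.1))

/-- Check of one branch `i ↦ i₀`: the factorisation of `P(i₀, y)` mod 17, the shape of every factor, and a kill for every
factor at some listed prime. [folklore] -/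
def branchCheck (o : Orbit27) (e fd : ℕ → ℕ) (R : ℕ → Option (List ℤ)) (primes : List ℕ) (i0 : ℤ)
    (facs : List Fac) : Bool :=
  prodCheck (specQi i0 o.P) (facs.map Fac.toList) &&
    facs.all fun f => factorOK f && primes.any fun q => killAt o e fd R i0 f q

/-- Certificate for one orbit: the monic factors of `P(4, y)` and of `P(13, y)` mod 17 (with multiplicity) and the kill
primes to try. [folklore] -/
structure Cert27 where
  /-- factors of `P(i ↦ 4)` mod 17 -/
  fac4 : List Fac
  /-- factors of `P(i ↦ 13 = −4)` mod 17 -/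
  fac13 : List Fac
  /-- kill primes -/
  primes : List ℕ

/-- **The orbit check** (what `decide` evaluates): both branches `i ↦ 4`, `i ↦ −4` pass `branchCheck`. [folklore] -/
def orbitCheck (o : Orbit27) (e fd : ℕ → ℕ) (R : ℕ → Option (List ℤ)) (c : Cert27) : Bool :=
  branchCheck o e fd R c.primes 4 c.fac4 && branchCheck o e fd R c.primes 13 c.fac13

/-! ## The nebentypus as an exponent of `i` (appended) -/

/-- Exponent table of the character `ψ = χ(127, ·)` (even, order 4, conductor 20) in PARI's convention `ψ(q) = i^{e(q)}`:
`e = 0` for `q ≡ ±1`, `1` for `q ≡ ±3` (i.e. `3, 17`), `2` for `q ≡ ±9`, `3` for `q ≡ ±7 (mod 20)` (certificate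
1f9122f05be32705 (N): `ψ(7) = −i`, `ψ(11) = −1`, `ψ(13) = −i`, `ψ(29) = −1`; [Che10, p.369]: "`G_{K_β/ℚ} ≅ (ℤ/20ℤ)*/{±1}`",
"normalized `ε(±3) = i`"). Junk `0` for `q` not coprime to 20 (never used). [cite: Chen2010, p.369 L5–11] -/
def charExp127 (q : ℕ) : ℕ :=
  if q % 20 = 3 ∨ q % 20 = 17 then 1
  else if q % 20 = 9 ∨ q % 20 = 11 then 2
  else if q % 20 = 7 ∨ q % 20 = 13 then 3
  else 0

/-- Exponent table of the CONJUGATE character `ψ̄ = χ(163, ·)` at 180, `χ(703, ·)` at 720: `ψ̄(q) = i^{−e(q)}`.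
[cite: Chen2010, p.369 L5–11] -/
def charExpConj (q : ℕ) : ℕ := (4 - charExp127 q) % 4

end SH27
end Summit.Ventures.AbcShadow
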